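/-
Copyright (c) 2026. All rights reserved.
Released under Apache 2.0 license as described in the file LICENSE.
Authors: abc-iut cell, Cor. 3.12 sub-crew seat abc-iut-c312-3 (gen 9).
-/
import Literature.IUT.LogVolume.UnitLogInnerRadiusTieRoots
import HarnessLib

/-!
# The inner radius at a TIE index `e = A·(p−1)` (`p` odd), V: the `ζ_p`-FREE leg WITHOUT the hypothesis `p ∤ A`
# — `ζ_p ∉ K ⇒ r_in = e/(p−1)` at EVERY multiple `e` of `p − 1`

Proof-only sequel (theorems, no definitions, no named fact) of `UnitLogInnerRadiusTieRoots.lean` (part II), which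
proved `ζ_p ∉ K ⇒ r_in = A` under `p ∤ A`.  The restriction entered only through the strictness of the levels
`s ≠ A`; when `p ∣ A` the levels `s = A/p^b` (`b ≥ 1`) are further TIE levels.  This file removes the restriction
on the `ζ_p`-free side by RAISING such levels to the critical one: for a principal unit `y` of level `s < A` the
`p`-th power has level EXACTLY `s·p` (`norm_one_sub_pow_prime_eq_of_lt_level`: the binomial middle terms have norm
`≤ ‖p‖·‖ϖ‖^s = ‖ϖ‖^{e+s} < ‖ϖ‖^{sp}` as `s(p−1) < e`), so `y^{p^b}` has level `A` and
`‖L(y)‖ = ‖L(y^{p^b})‖/‖p‖^b = ‖ϖ‖^{A − b·e}`.  Setting: `K` a proper ultrametric normed `ℚ_p`-algebra field,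
`p` ODD, `e = absRamificationIdx p K = A·(p−1)` (ANY `A ≥ 1`), `ϖ` a norm uniformizer, `c = ϖ^e/p`.

* §9 level raising (`norm_one_sub_pow_prime_eq_of_lt_level`, iterated `norm_one_sub_pow_prime_pow_eq_of_mul_eq`).
* §10 THE LIFT without `p ∤ A` (`exists_pow_prime_eq_one_of_unit_zero'`): the root of unity `ζ = y·u⁻¹` built in
  part II has level `≤ A` by construction, which is all the injectivity argument needs.
* §11 `ζ_p ∉ K` ⇒ `{‖z‖ ≤ ‖ϖ‖^A} ⊆ log_p(𝒪_K^×)` (`closedBall_level_subset_logUnits_of_forall_pow_prime_eq_one'`)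
  and the level-`A` exactness `‖L(1 + ϖ^A b)‖ = ‖ϖ‖^A` for units `b` (`norm_logSeries_level_eq_of_forall_pow_prime_eq_one`).
* §12 **no unit has `‖log_p u‖ = ‖ϖ‖^{A−1}`** when `ζ_p ∉ K` (`norm_unitLog_ne_zpow_pred'`: tie levels `A/p^b` give
  exponent `A − b·e`, the other levels are strict), hence **`r_in = A = e/(p−1)` EXACTLY for every `A`**
  (`innerRadius_tie_of_forall_pow_prime_eq_one'`: `closedBall 0 ‖ϖ‖^A ⊆ Λ ∧ ¬ closedBall 0 ‖ϖ‖^{A−1} ⊆ Λ`).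
The `ζ_p`-PRESENT side for `p ∣ A` is genuinely `K`-dependent beyond `(p, e, f, ζ_p)` (deeper tie levels interact
with `p^b`-th roots of `ζ_p`; cf. abc-iut-rp-d4's census) and is not treated.

References: [cite: NeukirchANT1999, Ch. II Prop. (5.5)–(5.7)] [cite: Washington1997, Lemma 1.4, §5.1].  Classical;
`logUnits` is the cell's typing of [IUTchIV] Prop. 1.2's `log_p(R^×)` ([claim: Mochizuki2012, status: disputed] for
that locution only).  Consumer (record only): D-0079 R-W lane U column «rho_in» at tie places with `p ∣ e/(p−1)` and
no `ζ_p` (e.g. `p ∈ {3, 5}` dividing `[F‡ : ℚ]`).  Nothing here is disputed mathematics; no IUT statement is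
asserted; nothing bears on [IUTchIII] Cor. 3.12.
-/

noncomputable section

open Metric Set
open scoped NormedField

namespace Literature.IUT.LogVolume

namespace LogEnvelope

open RamificationCriterion BoundaryRamification Literature.NumberTheory.GaloisRepresentations.Ultrametric
  IsLocalRing

section Field

variable (p : ℕ) [hp : Fact p.Prime]
variable {K : Type*} [NontriviallyNormedField K] [instK : NormedAlgebra ℚ_[p] K] [IsUltrametricDist K]
  [ProperSpace K]
variable {ϖ : Kˣ} (hϖ : IsUniformizer ϖ) {A : ℕ} (hA : absRamificationIdx p K = A * (p - 1))
include hϖ hA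

/-! ### §9. Level raising below the critical level: `U^{(s)} ∋ y ↦ y^p ∈ U^{(sp)}` exactly -/

/-- **`‖(1 + x)^p − 1‖ = ‖ϖ‖^{s·p}` for `‖x‖ = ‖ϖ‖^s`, `1 ≤ s < A`**: in `𝒪`, `(x + 1)^p = x^p + 1 + p·x·r`, and
`‖p·x·r‖ ≤ ‖ϖ‖^{e+s} < ‖ϖ‖^{s·p} = ‖x^p‖` because `s·(p−1) < e = A·(p−1)`. [cite: NeukirchANT1999, Ch. II (5.5)] -/
theorem norm_one_sub_pow_prime_eq_of_lt_level {x : K} {s : ℕ} (hsA : s < A) (hx : ‖x‖ = ‖(ϖ : K)‖ ^ s) :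
    ‖1 - (1 + x) ^ p‖ = ‖(ϖ : K)‖ ^ (s * p) := by
  have hρ0 : 0 < ‖(ϖ : K)‖ := norm_units_pos ϖ
  have hρ1 : ‖(ϖ : K)‖ ≤ 1 := hϖ.1.le
  have hx1 : ‖x‖ ≤ 1 := by rw [hx]; exact pow_le_one₀ hρ0.le hρ1
  set X : Valued.integer K := ⟨x, Valued.integer.mem_iff.mpr hx1⟩ with hX
  obtain ⟨r, hr⟩ := exists_add_pow_prime_eq hp.out X (1 : Valued.integer K)
  have hr' : (x + 1) ^ p = x ^ p + 1 + (p : K) * x * 1 * (r : K) := by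
    have := congrArg (fun z : Valued.integer K => (z : K)) hr
    simpa [hX] using this
  have hrn : ‖(r : K)‖ ≤ 1 := Valued.integer.norm_le_one r
  have hxp : ‖x ^ p‖ = ‖(ϖ : K)‖ ^ (s * p) := by rw [norm_pow, hx, ← pow_mul]
  have hsmall : ‖(p : K) * x * 1 * (r : K)‖ < ‖x ^ p‖ := by
    rw [hxp, mul_one, norm_mul, norm_mul, norm_prime_eq_norm_pow p K hϖ, hx]
    calc ‖(ϖ : K)‖ ^ absRamificationIdx p K * ‖(ϖ : K)‖ ^ s * ‖(r : K)‖
        ≤ ‖(ϖ : K)‖ ^ absRamificationIdx p K * ‖(ϖ : K)‖ ^ s * 1 := by gcongr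
      _ = ‖(ϖ : K)‖ ^ (absRamificationIdx p K + s) := by rw [mul_one, pow_add]
      _ < ‖(ϖ : K)‖ ^ (s * p) := by
          refine pow_lt_pow_right_of_lt_one₀ hρ0 hϖ.1 ?_
          rw [hA]
          have hp1 : 1 ≤ p := hp.out.one_le
          have hP : (2 : ℤ) ≤ (p : ℤ) := by exact_mod_cast hp.out.two_le
          zify [hp1, hsA.le]
          have h := mul_lt_mul_of_pos_right (show (s : ℤ) < A by exact_mod_cast hsA)
            (show (0 : ℤ) < (p : ℤ) - 1 by linarith)
          linarith
  rw [add_comm (1 : K) x, hr', show (1 : K) - (x ^ p + 1 + (p : K) * x * 1 * (r : K)) =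
      -(x ^ p + (p : K) * x * 1 * (r : K)) by ring, norm_neg,
    IsUltrametricDist.norm_add_eq_max_of_norm_ne_norm (ne_of_gt hsmall), max_eq_left hsmall.le, hxp]

/-- **Iterated level raising**: a principal unit of level `s ≥ 1` with `s·p^b = A` has `‖1 − y^{p^b}‖ = ‖ϖ‖^A`.
[cite: NeukirchANT1999, Ch. II (5.5)] -/
theorem norm_one_sub_pow_prime_pow_eq_of_mul_eq :
    ∀ (b : ℕ) {s : ℕ} {y : K}, 1 ≤ s → s * p ^ b = A → ‖1 - y‖ = ‖(ϖ : K)‖ ^ s →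
      ‖1 - y ^ p ^ b‖ = ‖(ϖ : K)‖ ^ A := by
  intro b
  induction b with
  | zero =>
    intro s y _ hsb hy
    rw [pow_zero, pow_one]
    rw [pow_zero, mul_one] at hsb
    rw [hy, hsb]
  | succ b ih =>
    intro s y hs1 hsb hy
    have hp2 : 2 ≤ p := hp.out.two_le
    -- `s < A` since `s·p^{b+1} = A` and `p^{b+1} ≥ 2`
    have hsA : s < A := by
      have h1 : 2 ≤ p ^ (b + 1) := le_trans hp2 (Nat.le_self_pow (Nat.succ_ne_zero b) p)
      have : s * 2 ≤ s * p ^ (b + 1) := Nat.mul_le_mul_left s h1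
      omega
    -- `y^p` has level `s·p`
    have hyp : ‖1 - (1 + (y - 1)) ^ p‖ = ‖(ϖ : K)‖ ^ (s * p) :=
      norm_one_sub_pow_prime_eq_of_lt_level p hϖ hA hsA (by rw [← norm_neg, neg_sub, hy])
    rw [add_sub_cancel] at hyp
    have h := ih (s := s * p) (y := y ^ p) (by nlinarith) (by rw [← hsb]; ring) hyp
    rwa [← pow_mul, ← pow_succ'] at h

/-! ### §10. The lift without `p ∤ A` -/

/-- **THE LIFT for every `A`**: a unit `a` with `‖a + c·a^p‖ < 1` (`c = ϖ^e/p`, `p` odd, `e = A(p−1)`) yields a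
non-trivial `p`-th root of unity — as in part II, but the level bound `‖1 − ζ‖ ≤ ‖ϖ‖^A` of `ζ = y·u⁻¹` is read off
directly (`‖y − u‖ = ‖ϖ‖^A`), so no strictness of the other levels is needed.
[cite: Washington1997, Lemma 1.4, §5.1] [cite: NeukirchANT1999, Ch. II (5.7)] -/
theorem exists_pow_prime_eq_one_of_unit_zero' (hp2 : p ≠ 2) {a : K} (ha : ‖a‖ = 1)
    (hΛ : ‖a + (ϖ : K) ^ absRamificationIdx p K / (p : K) * a ^ p‖ < 1) :
    ∃ ζ : K, ζ ^ p = 1 ∧ ζ ≠ 1 := by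
  have hρ0 : 0 < ‖(ϖ : K)‖ := norm_units_pos ϖ
  have hA1 := one_le_level p hA
  have hθ := pow_level_succ_mul_rpow_lt_one p hϖ hA
  set y : K := 1 + (ϖ : K) ^ A * a with hydef
  have hy1 : ‖1 - y‖ = ‖(ϖ : K)‖ ^ A := by
    rw [hydef, show (1 : K) - (1 + (ϖ : K) ^ A * a) = -((ϖ : K) ^ A * a) by ring, norm_neg, norm_mul,
      norm_pow, ha, mul_one]
  have hyP : IsPrincipal y := by
    show ‖1 - y‖ < 1
    rw [hy1]
    exact pow_lt_one₀ (norm_nonneg _) hϖ.1 (by omega)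
  have hLy : ‖logSeries y‖ ≤ ‖(ϖ : K)‖ ^ (A + 1) := by
    have hcong := norm_logSeries_sub_le_level p hϖ hA hp2 ha.le
    have hmain : ‖(ϖ : K) ^ A * (a + (ϖ : K) ^ absRamificationIdx p K / (p : K) * a ^ p)‖ ≤
        ‖(ϖ : K)‖ ^ (A + 1) := by
      rw [norm_mul, norm_pow, pow_succ]
      exact mul_le_mul_of_nonneg_left (hϖ.norm_le_of_norm_lt_one _ hΛ) (pow_nonneg hρ0.le _)
    have hsplit : logSeries y = (logSeries y -
        (ϖ : K) ^ A * (a + (ϖ : K) ^ absRamificationIdx p K / (p : K) * a ^ p)) +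
        (ϖ : K) ^ A * (a + (ϖ : K) ^ absRamificationIdx p K / (p : K) * a ^ p) := by ring
    rw [hsplit]
    exact (IsUltrametricDist.norm_add_le_max _ _).trans (max_le hcong hmain)
  obtain ⟨u, hu, huy⟩ := exists_logSeries_eq p K hθ hLy
  have huP : IsPrincipal u := lt_of_le_of_lt hu (pow_lt_one₀ (norm_nonneg _) hϖ.1 (by omega))
  have hu1 : ‖u‖ = 1 := huP.norm_eq_one
  have hu0 : u ≠ 0 := norm_ne_zero_iff.mp (by rw [hu1]; exact one_ne_zero)
  set ζ : K := y * u⁻¹ with hζdef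
  have hζP : IsPrincipal ζ := hyP.mul huP.inv
  have hLinv : logSeries u⁻¹ = -logSeries u := by
    have h := logSeries_mul p huP huP.inv
    rw [mul_inv_cancel₀ hu0, logSeries_one] at h
    linear_combination (-1 : K) * h
  have hLζ : logSeries ζ = 0 := by
    rw [hζdef, logSeries_mul p hyP huP.inv, hLinv, huy, add_neg_cancel]
  -- `‖y − u‖ = ‖ϖ‖^A`, so `ζ ≠ 1` and `‖1 − ζ‖ = ‖ϖ‖^A`
  have hyu : ‖y - u‖ = ‖(ϖ : K)‖ ^ A := by
    have hlt : ‖-(1 - u)‖ < ‖-(1 - y)‖ := by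
      rw [norm_neg, norm_neg, hy1]
      exact hu.trans_lt (pow_lt_pow_right_of_lt_one₀ hρ0 hϖ.1 (by omega))
    rw [show y - u = -(1 - y) + (1 - u) by ring, show (1 : K) - u = -(-(1 - u)) by ring,
      IsUltrametricDist.norm_add_eq_max_of_norm_ne_norm (by rw [norm_neg (-(1-u))]; exact (ne_of_gt hlt)),
      norm_neg (-(1 - u)), max_eq_left hlt.le, norm_neg, hy1]
  have hζ1' : ‖1 - ζ‖ = ‖(ϖ : K)‖ ^ A := by
    rw [hζdef, show (1 : K) - y * u⁻¹ = -((y - u) * u⁻¹) by field_simp; ring, norm_neg, norm_mul, hyu,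
      norm_inv, hu1, inv_one, mul_one]
  have hζ1 : ζ ≠ 1 := by
    intro h1
    rw [h1, sub_self, norm_zero] at hζ1'
    exact (ne_of_gt (pow_pos hρ0 _)) hζ1'.symm
  have hζp1 : ‖1 - ζ ^ p‖ ≤ ‖(ϖ : K)‖ ^ (A + 1) := by
    have h := norm_one_add_pow_prime_sub_one_le_level p hϖ hA (x := ζ - 1)
      (by rw [← norm_neg, neg_sub, hζ1'])
    rw [add_sub_cancel, ← norm_neg, neg_sub] at h
    exact h
  have hLζp : logSeries (ζ ^ p) = 0 := by rw [logSeries_pow p hζP, hLζ, mul_zero]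
  refine ⟨ζ, ?_, hζ1⟩
  have h1mem : (1 : K) ∈ {w : K | ‖1 - w‖ ≤ ‖(ϖ : K)‖ ^ (A + 1)} := by
    rw [Set.mem_setOf_eq, sub_self, norm_zero]; positivity
  exact logSeries_injOn p K hθ hζp1 h1mem (by rw [hLζp, logSeries_one])

/-! ### §11. `ζ_p ∉ K`: the critical level is full and exact, for every `A` -/

/-- **`ζ_p ∉ K` ⇒ `{‖z‖ ≤ ‖ϖ‖^A} ⊆ log_p(𝒪_K^×)` for EVERY `A`** (`p` odd, `e = A(p−1)`): part II's argument with the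
lift of §10. [cite: Washington1997, §5.1] [cite: NeukirchANT1999, Ch. II Prop. (5.7)] -/
theorem closedBall_level_subset_logUnits_of_forall_pow_prime_eq_one' (hp2 : p ≠ 2)
    (hμ : ∀ ζ : K, ζ ^ p = 1 → ζ = 1) : closedBall (0 : K) (‖(ϖ : K)‖ ^ A) ⊆ logUnits K := by
  intro z hz
  rw [mem_closedBall, dist_zero_right] at hz
  have hρ0 : 0 < ‖(ϖ : K)‖ := norm_units_pos ϖ
  have hA1 := one_le_level p hA
  have hϖA0 : (ϖ : K) ^ A ≠ 0 := pow_ne_zero _ ϖ.ne_zero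
  have hc1 := norm_coeff_level_eq_one p hϖ
  let C : Valued.integer K := ⟨(ϖ : K) ^ absRamificationIdx p K / (p : K), Valued.integer.mem_iff.mpr hc1.le⟩
  haveI := charP_residueField p K
  haveI : Finite (ResidueField (Valued.integer K)) := finite_residueField
  have hker := addPoly_ker_trivial_of_norm p C fun a ha hΛ => by
    by_contra hlt
    have ha1 : ‖a‖ = 1 := le_antisymm ha (not_lt.mp hlt)
    obtain ⟨ζ, hζ, hζ1⟩ := exists_pow_prime_eq_one_of_unit_zero' p hϖ hA hp2 ha1 hΛ
    exact hζ1 (hμ ζ hζ)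
  have hsurj := addPoly_surjective_of_ker p _ hker
  have hb : ‖z / (ϖ : K) ^ A‖ ≤ 1 := by
    rw [norm_div, norm_pow, div_le_one (pow_pos hρ0 _)]; exact hz
  obtain ⟨a, ha, hab⟩ := exists_norm_add_mul_pow_sub_lt_one_of_surjective p C hsurj (z / (ϖ : K) ^ A) hb
  have hab' : ‖a + (ϖ : K) ^ absRamificationIdx p K / (p : K) * a ^ p - z / (ϖ : K) ^ A‖ ≤ ‖(ϖ : K)‖ :=
    hϖ.norm_le_of_norm_lt_one _ hab
  have hcong := norm_logSeries_sub_le_level p hϖ hA hp2 ha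
  have hdiff : ‖z - logSeries (1 + (ϖ : K) ^ A * a)‖ ≤ ‖(ϖ : K)‖ ^ (A + 1) := by
    have hsplit : z - logSeries (1 + (ϖ : K) ^ A * a) =
        -((ϖ : K) ^ A * (a + (ϖ : K) ^ absRamificationIdx p K / (p : K) * a ^ p - z / (ϖ : K) ^ A)) +
        -(logSeries (1 + (ϖ : K) ^ A * a) -
          (ϖ : K) ^ A * (a + (ϖ : K) ^ absRamificationIdx p K / (p : K) * a ^ p)) := by
      rw [mul_sub, mul_div_cancel₀ _ hϖA0]; ring
    rw [hsplit]
    refine (IsUltrametricDist.norm_add_le_max _ _).trans (max_le ?_ ?_)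
    · rw [norm_neg, norm_mul, norm_pow, pow_succ]
      exact mul_le_mul_of_nonneg_left hab' (pow_nonneg hρ0.le _)
    · rw [norm_neg]
      exact hcong
  have h1 : z - logSeries (1 + (ϖ : K) ^ A * a) ∈ logUnits K := by
    refine closedBall_div_succ_subset_logUnits p hϖ ?_
    rw [div_eq_level p hA, mem_closedBall, dist_zero_right]
    exact hdiff
  have hyP : IsPrincipal (1 + (ϖ : K) ^ A * a) := by
    show ‖1 - (1 + (ϖ : K) ^ A * a)‖ < 1
    rw [show (1 : K) - (1 + (ϖ : K) ^ A * a) = -((ϖ : K) ^ A * a) by ring, norm_neg, norm_mul, norm_pow]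
    exact (mul_le_of_le_one_right (pow_nonneg hρ0.le _) ha).trans_lt
      (pow_lt_one₀ (norm_nonneg _) hϖ.1 (by omega))
  have h2 : logSeries (1 + (ϖ : K) ^ A * a) ∈ logUnits K := by
    rw [← unitLog_of_isPrincipal p hyP]; exact unitLog_mem_logUnits hyP.norm_eq_one
  have h3 := (logUnitsAddSubgroup p K).add_mem h1 h2
  rwa [sub_add_cancel] at h3

/-- **Level-`A` exactness when `ζ_p ∉ K`**: `‖L(1 + ϖ^A·b)‖ = ‖ϖ‖^A` for every unit `b` (were `b + c·b^p ∈ 𝔪`, the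
lift would produce `ζ_p`). [cite: NeukirchANT1999, Ch. II (5.5)] -/
theorem norm_logSeries_level_eq_of_forall_pow_prime_eq_one (hp2 : p ≠ 2)
    (hμ : ∀ ζ : K, ζ ^ p = 1 → ζ = 1) {b : K} (hb : ‖b‖ = 1) :
    ‖logSeries (1 + (ϖ : K) ^ A * b)‖ = ‖(ϖ : K)‖ ^ A := by
  have hρ0 : 0 < ‖(ϖ : K)‖ := norm_units_pos ϖ
  have hc1 := norm_coeff_level_eq_one p hϖ
  have hcong := norm_logSeries_sub_le_level p hϖ hA hp2 hb.le
  -- `b` is not a unit zero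
  have hnz : ‖b + (ϖ : K) ^ absRamificationIdx p K / (p : K) * b ^ p‖ = 1 := by
    have hle : ‖b + (ϖ : K) ^ absRamificationIdx p K / (p : K) * b ^ p‖ ≤ 1 := by
      refine (IsUltrametricDist.norm_add_le_max _ _).trans (max_le hb.le ?_)
      rw [norm_mul, hc1, one_mul, norm_pow, hb, one_pow]
    refine le_antisymm hle (not_lt.mp fun hlt => ?_)
    obtain ⟨ζ, hζ, hζ1⟩ := exists_pow_prime_eq_one_of_unit_zero' p hϖ hA hp2 hb hlt
    exact hζ1 (hμ ζ hζ)
  have hmain : ‖(ϖ : K) ^ A * (b + (ϖ : K) ^ absRamificationIdx p K / (p : K) * b ^ p)‖ = ‖(ϖ : K)‖ ^ A := by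
    rw [norm_mul, norm_pow, hnz, mul_one]
  have hlt : ‖logSeries (1 + (ϖ : K) ^ A * b) - (ϖ : K) ^ A * (b + (ϖ : K) ^ absRamificationIdx p K / (p : K) * b ^ p)‖
      < ‖(ϖ : K) ^ A * (b + (ϖ : K) ^ absRamificationIdx p K / (p : K) * b ^ p)‖ := by
    rw [hmain]
    exact hcong.trans_lt (pow_lt_pow_right_of_lt_one₀ hρ0 hϖ.1 (by omega))
  have hsplit : logSeries (1 + (ϖ : K) ^ A * b) =
      (ϖ : K) ^ A * (b + (ϖ : K) ^ absRamificationIdx p K / (p : K) * b ^ p) +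
      (logSeries (1 + (ϖ : K) ^ A * b) - (ϖ : K) ^ A * (b + (ϖ : K) ^ absRamificationIdx p K / (p : K) * b ^ p)) := by
    ring
  rw [hsplit, IsUltrametricDist.norm_add_eq_max_of_norm_ne_norm (ne_of_gt hlt), max_eq_left hlt.le, hmain]

/-! ### §12. The gap at `A − 1` and the inner radius, for every `A` -/

/-- **No unit has `‖log_p u‖ = ‖ϖ‖^{A−1}` when `ζ_p ∉ K`** (`p` odd, `e = A(p−1)`, ANY `A`): a prime-to-`p` principal
power `y` of `u` at a TIE level `s = A/p^b` has `‖L(y)‖ = ‖L(y^{p^b})‖/‖p‖^b = ‖ϖ‖^{A − b·e}` (§9, §11); at any other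
level the turning point is strict and the envelope exponent is `< s ≤ A − 1` or `= s ≥ A + 1`.
[cite: NeukirchANT1999, Ch. II (5.5)] -/
theorem norm_unitLog_ne_zpow_pred' (hp2 : p ≠ 2) (hμ : ∀ ζ : K, ζ ^ p = 1 → ζ = 1) (u : K) :
    ‖unitLog u‖ ≠ ‖(ϖ : K)‖ ^ ((A : ℤ) - 1) := by
  have hρ0 : 0 < ‖(ϖ : K)‖ := norm_units_pos ϖ
  have hP : (2 : ℤ) ≤ (p : ℤ) := by exact_mod_cast hp.out.two_le
  have hp1 : 1 ≤ p := hp.out.one_le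
  have hA1 := one_le_level p hA
  by_cases hu1 : ‖u‖ = 1
  swap
  · rw [unitLog_of_norm_ne_one hu1, norm_zero]
    exact (ne_of_gt (zpow_pos hρ0 _)).symm
  obtain ⟨m, hm0, hmp, hmP⟩ := exists_pow_isPrincipal_not_dvd (p := p) hu1
  rw [unitLog_eq_inv_mul_logSeries p hm0 hmP, norm_mul, norm_inv, norm_natCast_eq_one_of_not_dvd p hmp,
    inv_one, one_mul]
  by_cases hy1 : u ^ m = 1
  · rw [hy1, logSeries_one, norm_zero]
    exact (ne_of_gt (zpow_pos hρ0 _)).symm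
  set y : K := u ^ m with hydef
  have hx : (1 : K) - y ≠ 0 := sub_ne_zero.mpr (Ne.symm hy1)
  obtain ⟨s, hs⟩ := hϖ.2 (Units.mk0 (1 - y) hx)
  rw [Units.val_mk0] at hs
  have hs1 : 1 ≤ s := by
    have h1 : ‖(ϖ : K)‖ ^ s < 1 := hs ▸ hmP
    have := (zpow_lt_one_iff_right_of_lt_one₀ hρ0 hϖ.1).mp h1
    omega
  -- the level as a natural number
  obtain ⟨t, rfl⟩ : ∃ t : ℕ, s = (t : ℤ) := ⟨s.toNat, (Int.toNat_of_nonneg (by omega)).symm⟩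
  have ht1 : 1 ≤ t := by exact_mod_cast hs1
  have hst : ‖1 - y‖ = ‖(ϖ : K)‖ ^ t := by rw [hs, zpow_natCast]
  set e : ℕ := absRamificationIdx p K with he_def
  have heA : (e : ℤ) = (A : ℤ) * ((p : ℤ) - 1) := by
    rw [hA]; push_cast [Nat.cast_sub hp1]; ring
  have he2 : (2 : ℤ) ≤ (e : ℤ) := by
    have hp3 : (3 : ℤ) ≤ (p : ℤ) := by
      have : 3 ≤ p := by have := hp.out.two_le; omega
      exact_mod_cast this
    rw [heA]; nlinarith [show (1 : ℤ) ≤ A by exact_mod_cast hA1]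
  intro hEq
  by_cases htie : ∃ b : ℕ, t * p ^ b = A
  · -- TIE level `t = A/p^b`: raise to level `A`
    obtain ⟨b, hb⟩ := htie
    have hyb := norm_one_sub_pow_prime_pow_eq_of_mul_eq p hϖ hA b ht1 hb hst
    -- `y^{p^b} = 1 + ϖ^A·b'` with `b'` a unit
    have hϖA0 : (ϖ : K) ^ A ≠ 0 := pow_ne_zero _ ϖ.ne_zero
    set b' : K := (y ^ p ^ b - 1) / (ϖ : K) ^ A with hb'def
    have hb'1 : ‖b'‖ = 1 := by
      rw [hb'def, norm_div, ← norm_neg, neg_sub, hyb, norm_pow, div_self (pow_ne_zero _ hρ0.ne')]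
    have hyeq : y ^ p ^ b = 1 + (ϖ : K) ^ A * b' := by rw [hb'def, mul_div_cancel₀ _ hϖA0]; ring
    have hLb := norm_logSeries_level_eq_of_forall_pow_prime_eq_one p hϖ hA hp2 hμ hb'1
    rw [← hyeq, logSeries_pow p hmP, norm_mul] at hLb
    -- `‖p^b‖·‖L y‖ = ‖ϖ‖^A`, i.e. `‖L y‖ = ‖ϖ‖^{A − b e}`
    have hpb : ‖((p ^ b : ℕ) : K)‖ = ‖(ϖ : K)‖ ^ (e * b) := by
      rw [Nat.cast_pow, norm_pow, norm_prime_eq_norm_pow p K hϖ, ← pow_mul]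
    rw [hpb, hEq, ← zpow_natCast, ← zpow_add₀ hρ0.ne', ← zpow_natCast] at hLb
    have hexp := zpow_right_injective₀ hρ0 hϖ.1.ne hLb
    push_cast at hexp
    -- `e·b + (A − 1) = A` forces `e·b = 1`, impossible (`e ≥ 2` or `b = 0`)
    rcases Nat.eq_zero_or_pos b with hb0 | hb0
    · subst hb0
      simp at hexp
    · have : (1 : ℤ) ≤ (b : ℤ) := by exact_mod_cast hb0
      nlinarith
  · -- non-tie level: strict turning point, envelope exponent `≠ A − 1`
    push Not at htie
    obtain ⟨a₀, hlo, hhi⟩ := exists_turning_level (p := p) hs1 e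
    have hhi' : (e : ℤ) < (t : ℤ) * (p : ℤ) ^ a₀ * ((p : ℤ) - 1) := by
      refine lt_of_le_of_ne hhi fun heq => htie a₀ ?_
      have hq0 : (0 : ℤ) < (p : ℤ) - 1 := by linarith
      rw [heA] at heq
      have h := mul_right_cancel₀ hq0.ne' heq
      exact_mod_cast h.symm
    have hnorm := norm_logSeries_eq_zpow_level p hϖ hs1 hlo hhi' hs
    rw [hnorm] at hEq
    have hβ := zpow_right_injective₀ hρ0 hϖ.1.ne hEq
    have htA : (t : ℤ) ≠ A := by
      intro h
      exact htie 0 (by rw [pow_zero, mul_one]; exact_mod_cast h)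
    rcases lt_or_gt_of_ne htA with hlt | hgt
    · have hsl : (t : ℤ) * ((p : ℤ) - 1) < e := by
        rw [heA]; exact mul_lt_mul_of_pos_right hlt (by linarith)
      have ha₀ : a₀ ≠ 0 := by
        rintro rfl
        rw [pow_zero, mul_one] at hhi'
        exact absurd hhi' (not_lt.mpr hsl.le)
      have hmin := exponent_min (a₀ := a₀) hs1 hP hlo hhi'.le 1
      rw [pow_one, Nat.cast_one, mul_one] at hmin
      nlinarith
    · have ha₀ : a₀ = 0 := by
        by_contra h
        have h0 := hlo 0 (Nat.pos_of_ne_zero h)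
        rw [pow_zero, mul_one] at h0
        have : (A : ℤ) * ((p : ℤ) - 1) < (t : ℤ) * ((p : ℤ) - 1) := mul_lt_mul_of_pos_right hgt (by linarith)
        linarith
      subst ha₀
      rw [pow_zero, mul_one, Nat.cast_zero, mul_zero, sub_zero] at hβ
      omega

/-- **`{‖z‖ ≤ ‖ϖ‖^{A−1}} ⊄ log_p(𝒪_K^×)` when `ζ_p ∉ K`**, for every `A`. [cite: NeukirchANT1999, Ch. II (5.5)] -/
theorem not_closedBall_pred_subset_logUnits' (hp2 : p ≠ 2) (hμ : ∀ ζ : K, ζ ^ p = 1 → ζ = 1) :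
    ¬ closedBall (0 : K) (‖(ϖ : K)‖ ^ (A - 1)) ⊆ logUnits K := by
  intro h
  have hA1 := one_le_level p hA
  have hmem : (ϖ : K) ^ (A - 1) ∈ closedBall (0 : K) (‖(ϖ : K)‖ ^ (A - 1)) := by
    rw [mem_closedBall_zero_iff, norm_pow]
  obtain ⟨u, -, hu⟩ := h hmem
  refine norm_unitLog_ne_zpow_pred' p hϖ hA hp2 hμ u ?_
  rw [hu, norm_pow, ← zpow_natCast, Nat.cast_sub hA1, Nat.cast_one]

/-- **`ζ_p ∉ K` ⇒ `r_in = e/(p−1)` EXACTLY, at EVERY index `e` divisible by `p − 1`** (`p` odd): in the R-W format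
`closedBall 0 ‖ϖ‖^A ⊆ log_p(𝒪_K^×) ∧ ¬ closedBall 0 ‖ϖ‖^{A−1} ⊆ log_p(𝒪_K^×)` (part II's theorem without `p ∤ A`).
[cite: NeukirchANT1999, Ch. II Prop. (5.5)–(5.7)] -/
theorem innerRadius_tie_of_forall_pow_prime_eq_one' (hp2 : p ≠ 2) (hμ : ∀ ζ : K, ζ ^ p = 1 → ζ = 1) :
    closedBall (0 : K) (‖(ϖ : K)‖ ^ A) ⊆ logUnits K ∧
      ¬ closedBall (0 : K) (‖(ϖ : K)‖ ^ (A - 1)) ⊆ logUnits K :=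
  ⟨closedBall_level_subset_logUnits_of_forall_pow_prime_eq_one' p hϖ hA hp2 hμ,
    not_closedBall_pred_subset_logUnits' p hϖ hA hp2 hμ⟩

end Field

end LogEnvelope

end Literature.IUT.LogVolume

end
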